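import Mathlib
import HarnessLib
import Literature.Analysis.FluidPDE.KNSSBlowupLimitClassical
import Literature.Analysis.FluidPDE.VorticityEquation
import Literature.Analysis.FluidPDE.KNSSLineInvariantLiouville
import Literature.Analysis.FluidPDE.TaoEnstrophyLocalisation

/-!
# Route UnthreadedDoor · crux `PoloidalLiouville` (stmt-NavierStokesRegularity-1222, shared with
# route ThreadingFlux) · LINE «antidynamo» v2 — the BRIDGE stub `stub_vorticityOfClass`

Seat ns-qj-p1 g3 (keyed by director-ns KEY-NS #137), `--supports stmt-NavierStokesRegularity-1222 --as helper`.
Registered skeleton of record: planner ns-idea-6 g5, `PoloidalLiouville_antidynamo_birth_v2.lean`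
(sha16 `4ebf5683127baf3c`); this file proves its stub `StubVorticityOfClass` VERBATIM (binders restated —
a Theorems file cannot import the planner's HOME skeleton):

  a bounded ancient mild solution of Navier–Stokes (`ν = 1`, the tree's duality class
  `IsBoundedAncientMildSolution 1 v`) with measurable slices, whose velocity is jointly `C^∞` on the
  open slab `(−∞,0) × ℝ³`, solves the VORTICITY FORMULATION classically on `(−∞,0)`
  (`IsVorticitySolutionOn (Iio 0) 1 v`) and has bounded vorticity (`‖curl v(t) x‖ ≤ K`).

PROOF (all inputs are theorems of the tree).
1. *Classical on every window* (`exists_isClassicalNSSolutionOn_Ioo`): on `(t₀, 0)`, `t₀ < 0`, the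
   translate `w(t) = v(t + t₀)` is a duality-form mild solution from the bounded measurable datum
   `v(t₀)` (`IsAncientMildSolution.isMildNSSolutionOn_translate`), jointly smooth and uniformly bounded,
   so Fabes–Jones–Rivière 1972 Thm. 2.1 (tree theorem `classical_of_smooth_isMildNSSolutionOn_holds`)
   gives a smooth pressure with `(w, q)` classical; translate back. (This is the argument of the tree's
   `IsKNSSBlowupLimit.exists_isClassicalNSSolutionOn_Ioo` with the bound `M` of the class in place of
   the normalisation `|v| ≤ 1`.)
2. *Vorticity formulation* (`isVorticitySolutionOn_Iio`): on each open window the curl of the momentum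
   equation is the vorticity equation (Majda–Bertozzi Prop. 2.21, tree theorem
   `IsClassicalNSSolutionOn.isVorticitySolutionOn_of_isOpen`); the one-sided time derivatives within
   `(t − 1, 0)` and within `(−∞, 0)` agree at `t` (both sets are open, `derivWithin_of_isOpen`), so the
   windows glue.
3. *Bounded vorticity* (`exists_norm_curl_le`): `v` is a bounded weak solution on `(−∞,0)`
   (`IsBoundedAncientMildSolution.isBoundedWeakNSSolutionOn`, joint continuity gives the joint
   measurability on the slab), so KNSS 2009 §4 (tree theorem `KNSS2009_regularity_boundedWeak_ancient_holds`)
   gives a representative `U` with `‖∇ᵏU‖ ≤ C_k` on `ℝ³ × (−∞,0)` and `v(t) = U(t) + b(t)` a.e.; by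
   joint continuity `v(t,x) − v(t,y) = U(t,x) − U(t,y)` for EVERY `t < 0` (`repr_sub_eq_sub_of_ae`), hence
   `Dv(t) = DU(t)` and `‖curl v(t) x‖ ≤ ‖curl‖·C₁` (`norm_curl_le`).

HONEST FRAMING: a regularity bookkeeping statement about HYPOTHETICAL bounded ancient solutions
(blow-up profiles); it is the bridge stub of a line whose wall (`stub_scalarLiouville`) is OPEN.
Nothing here bears on `PoloidalLiouville` itself, on the UnthreadedDoor Target, or on Navier–Stokes
regularity; no summit statement is proved here. [folklore]

References: Koch–Nadirashvili–Seregin–Šverák, Acta Math. 203 (2009) §4 (arXiv:0709.3599 p. 8);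
Fabes–Jones–Rivière, ARMA 45 (1972) Thm. 2.1; Majda–Bertozzi, *Vorticity and Incompressible Flow*
(CUP 2002) Prop. 2.21.
-/

noncomputable section

-- the summit and its single sub-problem share the name (CONVENTIONS §1), as in every Theorems file
set_option linter.dupNamespace false

namespace Summit.NavierStokesRegularity.NavierStokesRegularity.Theorems.PoloidalLiouville

open MeasureTheory Set Function Filter
open _root_.Topology
open scoped ENNReal NNReal ContDiff
open Literature.Analysis.FluidPDE

variable {v : ℝ → EuclideanSpace ℝ (Fin 3) → EuclideanSpace ℝ (Fin 3)}

/-! ### 1. Classical on every window -/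

/-- **A jointly smooth bounded ancient mild solution is a classical Navier–Stokes solution on every
window `(t₀, 0)`, `t₀ < 0`** (unit viscosity, zero force), for some smooth pressure: mild in the
duality form between any two negative times + jointly smooth + bounded ⇒ classical (KNSS 2009 §4;
Fabes–Jones–Rivière 1972 Thm. 2.1, the tree's `classical_of_smooth_isMildNSSolutionOn_holds`; the
argument of `IsKNSSBlowupLimit.exists_isClassicalNSSolutionOn_Ioo` with a general bound `M`).
[cite: KochNadirashviliSereginSverak2009, §4 (bounded mild solutions are smooth and classical)] -/
theorem exists_isClassicalNSSolutionOn_Ioo (hB : IsBoundedAncientMildSolution 1 v)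
    (hm : ∀ t < 0, AEStronglyMeasurable (v t) volume)
    (hsm : ContDiffOn ℝ ∞ (uncurry v) (Iio 0 ×ˢ univ)) {t₀ : ℝ} (ht₀ : t₀ < 0) :
    ∃ p : ℝ → EuclideanSpace ℝ (Fin 3) → ℝ, IsClassicalNSSolutionOn (Ioo t₀ 0) 1 0 v p := by
  have hT : 0 < -t₀ := neg_pos.2 ht₀
  obtain ⟨M, hM⟩ := hB.isBoundedOn
  have hM' : ∀ t < 0, ∀ x, ‖v t x‖ ≤ M := fun t ht x => hM t ht x
  set w : ℝ → EuclideanSpace ℝ (Fin 3) → EuclideanSpace ℝ (Fin 3) := fun t => v (t + t₀) with hw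
  -- mild solution in duality form from the datum `v t₀` on `(0, -t₀)`
  have hmild : IsMildNSSolutionOn (Ioo 0 (-t₀)) 1 0 (v t₀) w :=
    (hB.isAncientMildSolution.isMildNSSolutionOn_translate t₀).mono Ioo_subset_Ico_self
  -- joint smoothness of the translate
  have hsmI : IsSmoothSpaceTimeOn (Iio 0) v := hsm
  have hsmw : IsSmoothSpaceTimeOn (Ioo 0 (-t₀)) w := by
    refine (hsmI.comp_add_right t₀).mono fun t ht => ?_
    simp only [mem_preimage, mem_Iio]
    linarith [ht.2]
  -- uniform bound `M` on `(0, T₁)`, `T₁ < -t₀`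
  have hbdd : ∀ T₁ ∈ Ioo 0 (-t₀), ∃ K : ℝ≥0∞, K < ⊤ ∧ ∀ t ∈ Ioo 0 T₁, eLpNorm (w t) ∞ volume ≤ K := by
    intro T₁ hT₁
    refine ⟨ENNReal.ofReal M, ENNReal.ofReal_lt_top, fun t ht => ?_⟩
    rw [eLpNorm_exponent_top]
    refine eLpNormEssSup_le_of_ae_bound (Eventually.of_forall fun x => ?_)
    have htt : t + t₀ < 0 := by linarith [ht.2, hT₁.2]
    exact hM' (t + t₀) htt x
  -- the datum: measurable and integrable against Gaussians (bounded by `M`)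
  have hu₀m : AEStronglyMeasurable (v t₀) volume := hm t₀ ht₀
  have hu₀G : ∀ a : ℝ, 0 < a →
      Integrable (fun y => Literature.Analysis.UnboundedOperators.heatKernel a y * ‖v t₀ y‖) volume := by
    intro a ha
    have hK : Integrable (Literature.Analysis.UnboundedOperators.heatKernel (E := EuclideanSpace ℝ (Fin 3)) a) volume :=
      Literature.Analysis.UnboundedOperators.integrable_heatKernel_holds ha
    have h := hK.bdd_mul (c := M) hu₀m.norm
      (Eventually.of_forall fun y => by
        rw [norm_norm]; exact hM' t₀ ht₀ y)
    refine h.congr (Eventually.of_forall fun y => ?_)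
    simp only [mul_comm]
  obtain ⟨q, hcl⟩ := classical_of_smooth_isMildNSSolutionOn_holds (EuclideanSpace ℝ (Fin 3)) one_pos hT
    hu₀m hu₀G hsmw hbdd hmild
  -- translate back to `(t₀, 0)`
  refine ⟨fun t => q (t - t₀), ?_⟩
  have h1 := hcl.comp_add_right (-t₀)
  have hset : (fun t : ℝ => t + -t₀) ⁻¹' Ioo 0 (-t₀) = Ioo t₀ 0 := by
    ext t
    simp only [mem_preimage, mem_Ioo]
    constructor
    · rintro ⟨h1, h2⟩; exact ⟨by linarith, by linarith⟩
    · rintro ⟨h1, h2⟩; exact ⟨by linarith, by linarith⟩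
  rw [hset] at h1
  have hf : (fun t : ℝ => (0 : ℝ → EuclideanSpace ℝ (Fin 3) → EuclideanSpace ℝ (Fin 3)) (t + -t₀)) = 0 := by
    funext t; rfl
  have hu' : (fun t : ℝ => w (t + -t₀)) = v := by
    funext t; simp only [hw]; congr 1; ring
  have hp' : (fun t : ℝ => q (t + -t₀)) = fun t => q (t - t₀) := by
    funext t; rw [← sub_eq_add_neg]
  rw [hf, hu', hp'] at h1
  exact h1

/-! ### 2. The vorticity formulation on `(−∞, 0)` -/

/-- The vorticity formulation on every open window `(t₀, 0)`, `t₀ < 0` (curl of the momentum equation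
of the classical solution of `exists_isClassicalNSSolutionOn_Ioo`; Majda–Bertozzi Prop. 2.21, tree
theorem `IsClassicalNSSolutionOn.isVorticitySolutionOn_of_isOpen`). [folklore] -/
theorem isVorticitySolutionOn_Ioo (hB : IsBoundedAncientMildSolution 1 v)
    (hm : ∀ t < 0, AEStronglyMeasurable (v t) volume)
    (hsm : ContDiffOn ℝ ∞ (uncurry v) (Iio 0 ×ˢ univ)) {t₀ : ℝ} (ht₀ : t₀ < 0) :
    IsVorticitySolutionOn (Ioo t₀ 0) 1 v := by
  obtain ⟨p, hcl⟩ := exists_isClassicalNSSolutionOn_Ioo hB hm hsm ht₀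
  exact hcl.isVorticitySolutionOn_of_isOpen isOpen_Ioo fun _ _ x => curl_zero x

/-- **The vorticity formulation on the whole open slab `(−∞, 0)`**: the windows `(t − 1, 0)` glue,
because one-sided time derivatives within two open time sets containing `t` coincide
(`derivWithin_of_isOpen`). [folklore] -/
theorem isVorticitySolutionOn_Iio (hB : IsBoundedAncientMildSolution 1 v)
    (hm : ∀ t < 0, AEStronglyMeasurable (v t) volume)
    (hsm : ContDiffOn ℝ ∞ (uncurry v) (Iio 0 ×ˢ univ)) :
    IsVorticitySolutionOn (Iio 0) 1 v where
  smooth_velocity := hsm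
  vorticity_eq t ht x := by
    have ht' : t ∈ Ioo (t - 1) 0 := ⟨by linarith, ht⟩
    have hV := isVorticitySolutionOn_Ioo hB hm hsm (t₀ := t - 1) (by linarith [mem_Iio.1 ht])
    have key := hV.vorticity_eq t ht' x
    have h1 : timeDerivWithin (Iio 0) (vorticity v) t x =
        timeDerivWithin (Ioo (t - 1) 0) (vorticity v) t x := by
      rw [timeDerivWithin_apply, timeDerivWithin_apply, derivWithin_of_isOpen isOpen_Iio ht,
        derivWithin_of_isOpen isOpen_Ioo ht']
    rw [h1]
    exact key
  divFree t ht :=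
    (isVorticitySolutionOn_Ioo hB hm hsm (t₀ := t - 1) (by linarith [mem_Iio.1 ht])).divFree t
      ⟨by linarith, ht⟩

/-! ### 3. Bounded vorticity -/

/-- **KNSS 2009 §4 for a jointly continuous member of the class: the vorticity is bounded on
`(−∞, 0) × ℝ³`.** `v` is a bounded weak solution, its §4 representative `U` (`v = U + b(t)` a.e.,
`‖∇ᵏU‖ ≤ C_k`) differs from the continuous `v(t)` by a spatial constant at EVERY time
(`repr_sub_eq_sub_of_ae`), so `Dv(t) = DU(t)` and `‖curl v(t) x‖ ≤ ‖curl‖ · C₁`.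
[cite: KochNadirashviliSereginSverak2009, §4 (4.7) p. 8; §5 proof of Thm 5.2, first sentence (arXiv p. 10)] -/
theorem exists_norm_curl_le (hB : IsBoundedAncientMildSolution 1 v)
    (hsm : ContDiffOn ℝ ∞ (uncurry v) (Iio 0 ×ˢ univ)) :
    ∃ K : ℝ, ∀ t < 0, ∀ x, ‖curl (v t) x‖ ≤ K := by
  have hcont : ContinuousOn (uncurry v) (Iio 0 ×ˢ univ) := hsm.continuousOn
  have hmeas : AEStronglyMeasurable (uncurry v)
      ((volume : Measure (ℝ × EuclideanSpace ℝ (Fin 3))).restrict (Iio 0 ×ˢ univ)) :=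
    hcont.aestronglyMeasurable (measurableSet_Iio.prod MeasurableSet.univ)
  have hsl : ∀ t < 0, AEStronglyMeasurable (v t) volume := fun t ht =>
    (continuous_slice_of_continuousOn_Iio hcont ht).aestronglyMeasurable
  have hw : IsBoundedWeakNSSolutionOn (Iio 0) isOpen_Iio 1 v :=
    hB.isBoundedWeakNSSolutionOn one_pos hmeas hsl
  obtain ⟨U, b, -, -, -, hae, hsmooth, -, hbd, hlip, -⟩ :=
    KNSS2009_regularity_boundedWeak_ancient_holds hw
  have hsub := repr_sub_eq_sub_of_ae hcont hae hsmooth hlip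
  obtain ⟨C₁, hC₁⟩ := hbd 1
  refine ⟨‖(curlCLM : (EuclideanSpace ℝ (Fin 3) →L[ℝ] EuclideanSpace ℝ (Fin 3)) →L[ℝ]
      EuclideanSpace ℝ (Fin 3))‖ * C₁, fun t ht x => ?_⟩
  -- `v t = U t + (v t 0 - U t 0)`, so the derivatives agree
  have hvt : v t = fun y => U t y + (v t 0 - U t 0) := by
    funext y
    have h' : U t y - U t 0 = v t y - v t 0 := hsub t ht y 0
    calc v t y = (v t y - v t 0) + v t 0 := by abel
      _ = (U t y - U t 0) + v t 0 := by rw [h']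
      _ = U t y + (v t 0 - U t 0) := by abel
  have hfd : fderiv ℝ (v t) x = fderiv ℝ (U t) x := by
    rw [hvt, fderiv_add_const]
  have hcurl : curl (v t) x = curl (U t) x := by
    rw [curl, curl, hfd]
  have hD : ‖fderiv ℝ (U t) x‖ ≤ C₁ := by
    have h := hC₁ t ht x
    rwa [← norm_iteratedFDeriv_fderiv, norm_iteratedFDeriv_zero] at h
  calc ‖curl (v t) x‖ = ‖curl (U t) x‖ := by rw [hcurl]
    _ ≤ ‖(curlCLM : (EuclideanSpace ℝ (Fin 3) →L[ℝ] EuclideanSpace ℝ (Fin 3)) →L[ℝ]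
          EuclideanSpace ℝ (Fin 3))‖ * ‖fderiv ℝ (U t) x‖ := norm_curl_le (U t) x
    _ ≤ _ := by gcongr

/-! ### The registered stub, verbatim -/

/-- **Stub `stub_vorticityOfClass` of the registered v2 skeleton of crux `PoloidalLiouville`
(stmt-NavierStokesRegularity-1222; LINE «antidynamo», planner ns-idea-6 g5, sha16 `4ebf5683127baf3c`),
signature VERBATIM (`StubVorticityOfClass`).** A bounded ancient mild solution (`ν = 1`, duality class)
with measurable slices and jointly `C^∞` velocity on `(−∞,0) × ℝ³` solves the vorticity formulation
classically on `(−∞, 0)` and has bounded vorticity. Conditional on nothing; it is the BRIDGE of the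
line, whose wall `stub_scalarLiouville` is OPEN — nothing here proves `PoloidalLiouville` or bears on
Navier–Stokes regularity. [cite: KochNadirashviliSereginSverak2009, §4 p. 8 (bounded mild ancient solutions are smooth with bounded derivatives and solve the equations classically)] -/
theorem vorticityOfClass :
    ∀ (v : ℝ → EuclideanSpace ℝ (Fin 3) → EuclideanSpace ℝ (Fin 3)),
    Literature.Analysis.FluidPDE.IsBoundedAncientMildSolution 1 v →
    (∀ t < 0, AEStronglyMeasurable (v t) volume) →
    ContDiffOn ℝ (⊤ : ℕ∞) (Function.uncurry v) (Set.Iio 0 ×ˢ Set.univ) →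
    Literature.Analysis.FluidPDE.IsVorticitySolutionOn (Set.Iio 0) 1 v ∧
      ∃ K : ℝ, ∀ t < 0, ∀ x, ‖Literature.Analysis.FluidPDE.curl (v t) x‖ ≤ K :=
  fun _ hB hm hsm => ⟨isVorticitySolutionOn_Iio hB hm hsm, exists_norm_curl_le hB hsm⟩

/-- Alias under the skeleton's stub name. [folklore] -/
theorem stub_vorticityOfClass :
    ∀ (v : ℝ → EuclideanSpace ℝ (Fin 3) → EuclideanSpace ℝ (Fin 3)),
    Literature.Analysis.FluidPDE.IsBoundedAncientMildSolution 1 v →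
    (∀ t < 0, AEStronglyMeasurable (v t) volume) →
    ContDiffOn ℝ (⊤ : ℕ∞) (Function.uncurry v) (Set.Iio 0 ×ˢ Set.univ) →
    Literature.Analysis.FluidPDE.IsVorticitySolutionOn (Set.Iio 0) 1 v ∧
      ∃ K : ℝ, ∀ t < 0, ∀ x, ‖Literature.Analysis.FluidPDE.curl (v t) x‖ ≤ K :=
  vorticityOfClass

end Summit.NavierStokesRegularity.NavierStokesRegularity.Theorems.PoloidalLiouville

end
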